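import Summits.NavierStokesRegularity.OSWSelfSimilar.SheetRGeneratorOddDense
import Literature.Analysis.UnboundedOperators.HilleYosidaRescaled
import Literature.Analysis.UnboundedOperators.SemigroupGeneratorEigenvector
import HarnessLib

/-!
# SHEET-ℝ frame, Z3-SR-SPEC (P9): the linearised operator on the odd class GENERATES a C₀-semigroup
# `S(τ) = e^{τT}`, `T = generatorOdd = −A_F|odd`, with `‖S(τ)‖ ≤ e^{−mτ}` — Hille–Yosida applied to `resolventOdd`

HONEST FRAMING (cell ns-blowup GROUP B / zone Z3, case Z3-SR-SPEC, P-list item (P9) «C₀-semigroup generation», NOT CLAIMED in the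
word of record; 1-D MODEL certificate frame (viscous gCLM/OSW sheet on the line); not Euler/NS; «violates: none — MODEL»).  Nothing here
asserts that a profile exists; the Gårding datum of the perturbed form ((S1), interval arithmetic) is the HYPOTHESIS `GardingDataKC`, and
`K : Esp L hL →L[ℝ] W L` is an arbitrary bounded real operator (cert-1: `K = −P + F`, the non-local part and the rank-one gauge feedback).

selfsim g11/g12 built, from the datum `h : GardingDataKC L hL d V K D₀ D₁ V₀ c m`, the resolvent `R_K(σ) = resolventOdd hL K h σ` on the odd
class `Wcodd L ⊂ L²_w(ℂ)` — an injective pseudo-resolvent on `{Re σ > −m}` with the SHARP PIVOT BOUND `‖R_K(σ)G‖ ≤ ‖G‖/(m + Re σ)` — and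
Kato's closed operator `T = generatorOdd hL K h σ₀ hσ₀` with `R_K(σ) = (σ − T)⁻¹` (`T = −A_F` weakly, `SheetRGeneratorOddWeak.mem_domain_iff`).
The generic HILLE–YOSIDA GENERATION THEOREM of `Literature/Analysis/UnboundedOperators/HilleYosida{Approximants,Semigroup,Generator,
Rescaled}.lean` (Engel–Nagel II Thm. 3.5 / Cor. 3.6, pseudo-resolvent form) turns exactly these two facts plus the DENSITY OF `D(T)` (profile-cert-5's
`SheetRGeneratorOddDense.dense_domain_generatorOdd`: compactly supported odd smooth functions lie in `D(T)` and are dense) into: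

* **`exists_c0Semigroup`** — there is a C₀-semigroup `S` on `Wcodd L` (the tree's `C0Semigroup ℂ`) with **`‖S(τ)‖ ≤ e^{−mτ}`**, whose
  Laplace transform is `R_K` (`∫₀^∞ e^{−στ}S(τ)G dτ = R_K(σ)G`, `Re σ > −m`) and whose generator IS `T = generatorOdd hL K h σ₀ hσ₀`;
  i.e. the linearised flow `δ(τ) = S(τ)δ₀` of `δ' = −A_F δ` exists for every `δ₀ ∈ L²_{w,odd}(ℂ)`, is differentiable for `δ₀ ∈ D(T)` with
  `δ' = Tδ` (`hasDerivWithinAt_orbit`, Engel–Nagel II.1.3), and decays at the coercivity rate `m` in operator norm;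
* `app_eq_exp_smul_of_eigen` — eigenvectors of `T` evolve as `S(τ)u = e^{μτ}u` (the gauge mode `σ = 1` of the FULL operator lives in the
  rank-one perturbation `T + θℓ(·)f`, not in `T`; recorded here for the coercive part only).

So the ONLY hypothesis is the (S1) datum `h : GardingDataKC …` (interval arithmetic of record): (P9) for the coercive operator `T = −A_F|odd` reads
KERNEL modulo (S1).  The renewal route to «linearly stable modulo gauge» (cert-5's P9-P10-RENEWAL-DESIGN.md §1) needs exactly the decay
`‖S(τ)‖ ≤ e^{−mτ}` delivered here; the flow of the FULL linearisation `−DG(Ω*) = T + θℓ(·)f` (bounded rank-one perturbation) is the next file.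
No definition, no named fact.  WHAT THIS IS NOT: not NS; not (P10) (no growth bound for the rank-one-perturbed semigroup is claimed); no
number of record moves; «a semigroup for the MODEL linearisation is not an NS statement».
-/

noncomputable section

namespace Summit.NavierStokesRegularity.OSWSelfSimilar
namespace SheetRLinearisedSemigroup

open _root_.MeasureTheory _root_.Set _root_.Filter SheetREnergySpace SheetRComplexPivot SheetRPerturbedResolventC SheetROddClass
  SheetRResolventOddClass Literature.Analysis.OperatorTheory Literature.Analysis.UnboundedOperators
open scoped Topology NNReal

variable {L D₀ D₁ V₀ c m : ℝ} {d V : ℝ → ℝ}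

/-! ### §1 The Hille–Yosida hypotheses for `resolventOdd` -/

/-- A real `λ > −m` lies in the half-plane `{Re σ > −m}`. [folklore] -/
theorem ofReal_mem_halfPlane {l : ℝ} (hl : -m < l) : ((l : ℂ)) ∈ {σ : ℂ | -m < σ.re} := by
  simpa using hl

/-- **The Hille–Yosida bound for the sheet resolvent**: `‖R_K(λ)‖ ≤ 1/(λ + m)` for real `λ > −m` (operator norm on the odd class; from the
sharp pivot bound `norm_resolventOdd_le_inv`). [folklore] -/
theorem norm_resolventOdd_le (hL : 0 < L) (K : Esp L hL →L[ℝ] W L) (h : GardingDataKC L hL d V K D₀ D₁ V₀ c m) {l : ℝ} (hl : -m < l) :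
    ‖resolventOdd hL K h l‖ ≤ (l + m)⁻¹ := by
  have hlm : 0 < l + m := by linarith
  refine ContinuousLinearMap.opNorm_le_bound _ (inv_nonneg.2 hlm.le) fun G => ?_
  have hb := norm_resolventOdd_le_inv hL K h (σ := (l : ℂ)) (by simpa using hl) G
  rw [Complex.ofReal_re] at hb
  calc ‖resolventOdd hL K h l G‖ ≤ ‖G‖ / (m + l) := hb
    _ = (l + m)⁻¹ * ‖G‖ := by rw [div_eq_inv_mul, add_comm]

/-! ### §2 (P9): the semigroup generated by `T = generatorOdd` -/

/-- **Z3-SR-SPEC (P9) — C₀-SEMIGROUP GENERATION FOR THE SHEET LINEARISATION (modulo the (S1) datum only).**  For a Gårding datum `h` of the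
perturbed form (the (S1) sentence: `c∫wδ₁² + m∫wδ² ≤ ⟨A_F δ, wδ⟩` on tests) and `σ₀` with `Re σ₀ > −m`, the domain `Ran R_K(σ₀)` of
`T = generatorOdd hL K h σ₀ hσ₀` being dense in the odd class (cert-5's `dense_domain_generatorOdd`), there is a C₀-semigroup `S` on `Wcodd L` with `‖S(τ)‖ ≤ e^{−mτ}` for all
`τ ≥ 0`, with Laplace transform `∫₀^∞ e^{−στ}S(τ)G dτ = R_K(σ)G` for every `Re σ > −m`, and with generator EQUAL to `T` (as partially
defined operators).  Hille–Yosida (Engel–Nagel II Cor. 3.6) applied to the injective pseudo-resolvent `resolventOdd` with its pivot bound.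
1-D MODEL; conditional on the interval datum (S1) through `h` ONLY; NOT Navier–Stokes. [cite: EngelNagel2000, Ch. II Cor. 3.6] -/
theorem exists_c0Semigroup (hL : 0 < L) (K : Esp L hL →L[ℝ] W L) (h : GardingDataKC L hL d V K D₀ D₁ V₀ c m) {σ₀ : ℂ} (hσ₀ : -m < σ₀.re) :
    ∃ S : C0Semigroup ℂ (Wcodd L), (∀ τ : ℝ≥0, ‖S.app τ‖ ≤ Real.exp (-m * τ)) ∧
      (∀ σ : ℂ, -m < σ.re → ∀ G : Wcodd L, S.laplaceResolventFun σ G = resolventOdd hL K h σ G) ∧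
      S.generator = generatorOdd hL K h σ₀ hσ₀ := by
  haveI : CompleteSpace (Wcodd L) := completeSpace_Wcodd L
  have hdense : Dense (Set.range (resolventOdd hL K h σ₀)) := by
    have hd := SheetRGeneratorOddDense.dense_domain_generatorOdd hL K h hσ₀
    rw [generatorOdd_domain] at hd
    simpa only [LinearMap.coe_range, ContinuousLinearMap.coe_coe] using hd
  obtain ⟨S, hS, hlap, hgen⟩ := HilleYosida.exists_c0Semigroup_of_resolvent_bound (isPseudoResolvent_resolventOdd hL K h)
    (fun l hl => ofReal_mem_halfPlane hl) (fun l hl => norm_resolventOdd_le hL K h hl) hσ₀ hσ₀ hdense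
  exact ⟨S, hS, fun σ hσ G => hlap σ hσ hσ G, hgen⟩

/-! ### §3 What the semigroup does: orbits on the domain, eigenvectors -/

/-- **The linearised flow on the domain**: for the semigroup of `exists_c0Semigroup` (indeed for ANY C₀-semigroup `S` on the odd class whose
generator is `T`) and `u ∈ D(T)`, the orbit `τ ↦ S(τ)u` is right-differentiable at every `τ ≥ 0` with derivative `S(τ)(Tu)` — the MODEL
linearised evolution `δ' = Tδ = −A_F δ` is solved by `δ(τ) = S(τ)δ₀` (Engel–Nagel II Lemma 1.3 (ii), tree `hasDerivWithinAt_Ici_app_of_mem`).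
[cite: EngelNagel2000, Ch. II Lemma 1.3] -/
theorem hasDerivWithinAt_orbit (hL : 0 < L) (K : Esp L hL →L[ℝ] W L) (h : GardingDataKC L hL d V K D₀ D₁ V₀ c m) {σ₀ : ℂ} (hσ₀ : -m < σ₀.re)
    (S : C0Semigroup ℂ (Wcodd L)) (hgen : S.generator = generatorOdd hL K h σ₀ hσ₀)
    {u : Wcodd L} (hu : u ∈ (generatorOdd hL K h σ₀ hσ₀).domain) (τ : ℝ≥0) :
    HasDerivWithinAt (fun s : ℝ => S.app s.toNNReal u) (S.app τ (generatorOdd hL K h σ₀ hσ₀ ⟨u, hu⟩)) (Set.Ici (τ : ℝ)) τ := by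
  have hu' : u ∈ S.generator.domain := by rw [hgen]; exact hu
  have hd := S.hasDerivWithinAt_Ici_app_of_mem ⟨u, hu'⟩ τ
  have heq : S.generator ⟨u, hu'⟩ = generatorOdd hL K h σ₀ hσ₀ ⟨u, hu⟩ := by
    have hgraph : ((u : Wcodd L), S.generator ⟨u, hu'⟩) ∈ (generatorOdd hL K h σ₀ hσ₀).graph := by
      rw [← hgen]; exact S.generator.mem_graph ⟨u, hu'⟩
    exact ((generatorOdd hL K h σ₀ hσ₀).mem_graph_snd_inj (LinearPMap.mem_graph _ ⟨u, hu⟩) hgraph rfl).symm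
  rw [heq] at hd
  exact hd

/-- **Eigenvectors evolve exponentially**: if `Tu = μu` (`u ∈ D(T)`) then `S(τ)u = e^{μτ}u` for every C₀-semigroup `S` on the odd class
with generator `T` (tree `C0Semigroup.app_eq_exp_smul_of_generator_eq`). [cite: EngelNagel2000, Ch. IV §3 / Ch. II Lemma 1.3] -/
theorem app_eq_exp_smul_of_eigen (hL : 0 < L) (K : Esp L hL →L[ℝ] W L) (h : GardingDataKC L hL d V K D₀ D₁ V₀ c m) {σ₀ : ℂ}
    (hσ₀ : -m < σ₀.re) (S : C0Semigroup ℂ (Wcodd L)) (hgen : S.generator = generatorOdd hL K h σ₀ hσ₀)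
    {u : Wcodd L} (hu : u ∈ (generatorOdd hL K h σ₀ hσ₀).domain) {μ : ℂ} (heig : generatorOdd hL K h σ₀ hσ₀ ⟨u, hu⟩ = μ • u) (τ : ℝ≥0) :
    S.app τ u = Complex.exp (μ * τ) • u := by
  haveI : CompleteSpace (Wcodd L) := completeSpace_Wcodd L
  have hu' : u ∈ S.generator.domain := by rw [hgen]; exact hu
  have heq : S.generator ⟨u, hu'⟩ = μ • u := by
    have hgraph : ((u : Wcodd L), S.generator ⟨u, hu'⟩) ∈ (generatorOdd hL K h σ₀ hσ₀).graph := by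
      rw [← hgen]; exact S.generator.mem_graph ⟨u, hu'⟩
    rw [← heig]
    exact ((generatorOdd hL K h σ₀ hσ₀).mem_graph_snd_inj (LinearPMap.mem_graph _ ⟨u, hu⟩) hgraph rfl).symm
  exact C0Semigroup.app_eq_exp_smul_of_generator_eq S ⟨u, hu'⟩ heq τ

end SheetRLinearisedSemigroup
end Summit.NavierStokesRegularity.OSWSelfSimilar

end
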